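import Summits.BirchSwinnertonDyer.Rank1Residual.AdditivePotMult.SelmerCotorsionTransferOdd
import Summits.BirchSwinnertonDyer.Rank1Residual.AdditivePotMult.NonPrimitiveLambdaTransferOdd
import Summits.BirchSwinnertonDyer.Rank1Residual.Additive.RamifiedOrdinaryLineQuotientInvariantsModelFree
import HarnessLib

/-!
# The Greenberg–Vatsal transfer COUNT and its `μ` / `λ` / cotorsion consequences at the ramified
# ordinary line — MODEL-FREE: any two congruent curves over `ℚ` with MATCHING ramified ordinary lines
# at an odd `p`, no class hypothesis (cell `b2b-bsdres`, team n1011, seat p12 (gen 6); row T-GV29-MF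
# FILE B; the gen-5 `…_of_forall_lines` assembly with its Remark-(2.9) clauses DISCHARGED by
# `RamifiedOrdinaryLineQuotientInvariantsModelFree`)

HONEST FRAMING (cell `b2b-bsdres`, run/shared/lean/b2b/bsd-rank1-residual/, verbatim in every
file): the goal of the cell is to DELETE the COMBINATION-SHAPED residual classes of the
Birch–Swinnerton-Dyer formula for ALL analytic-rank `≤ 1` elliptic curves over `ℚ` — "full BSD
formula for every rank `≤ 1` curve in class `C`" assembled STRICTLY from published theorems — so
that the rank-`≤ 1` remainder becomes exactly the CONSTRUCTION-SHAPED classes, which are TYPED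
(missing-input `Prop`s), NOT attempted. This is not "finishing BSD". Team n1011: research routes on
CONSTRUCTION-SHAPED classes; prove what is provable now; no claim beyond stated classes; census
output = EVIDENCE, never a Literature fact; RESIDUAL-MAP marks UNCHANGED; nothing is booked by this
file. THEOREMS ONLY: no definition, no named fact; the gen-5 assembly files are consumed BY NAME.

## What

The gen-5 `ℚ`-assembly `exists_data_natCard_gvSelmerInfty_inf_torsion_eq_of_forall_lines` (GV p. 27:
"the order of `S^{Σ₀}_{A_i[p]}(ℚ_∞)` is independent of `i`") asks, at the place `v ∋ p`, for ramified
ordinary lines `C₁`, `C₂` which (a) satisfy GV Remark (2.9)'s clause `(E_i[p^∞]/C_i)^{ker κ ⊓ I_v} = 0`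
and (b) MATCH under every `Γ_ℚ`-equivariant `E₁[p] ≃+ E₂[p]`. Clause (a) is now a THEOREM for every
ramified ordinary line (`gr_invariants_eq_zero_of_isRamifiedOrdinaryLine`, FILE A2), so only the
matching clause (b) remains — for ANY two elliptic curves over `ℚ`, any odd `p`, any `ℤ_p`-extension:

* `exists_data_natCard_gvSelmerInfty_inf_torsion_eq_of_matching` — the COUNT
  `#(S^{S₀}_{E₁[p^∞]}(ℚ_∞) ⊓ H¹[p]) = #(S^{S₀}_{E₂[p^∞]}(ℚ_∞) ⊓ H¹[p])`;
* `natCard_torsionBy_nonPrimitiveSelmerInfty_eq_of_matching` — `#Sel^{Σ₀}_{E₁}(ℚ_∞)_p[p] =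
  #Sel^{Σ₀}_{E₂}(ℚ_∞)_p[p]` (`κ` cyclotomic; the R-D identifications `RamifiedLineKummerEqAt W_i p` as
  explicit binders, exactly as in gen 5 FILE 3);
* `nonPrimitive_isTorsion_and_mu_eq_zero_of_matching`, `nonPrimitive_lambdaInvariant_eq_of_matching`,
  `selmer_isTorsion_and_mu_eq_zero_of_matching` — the `μ` / `λ(X^{Σ₀})` / primitive-cotorsion
  transfers of gen 5 FILES 4–6 on such pairs.

Customers: congruent pairs on the (G-ord, `e ∈ {3,4,6}`) rows (team row T-ROL-G supplies the lines;
the matching clause is the one input left there), and the four `e = 2` loci uniformly (where gen-5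
FILE 1 proves matching). NOT here: matching itself (it is a genuine condition when the two
semistability defects differ), the R-D identification, the E₁-side input `X^{Σ₀}_1` torsion with
`μ = 0` from the PRIMITIVE `X₁` (needs GV Prop. (2.4): `𝓗_ℓ(ℚ_∞)[p]` finite for `ℓ ≠ p` — not in the
tree), GV (7).

References: [GreenbergVatsal2000] §2 Prop. (2.8), Remark (2.9), Cor. (2.3), pp. 26–27
(arXiv:math/9906215); [GreenbergLNM1716] Prop. 5.10.
-/

set_option autoImplicit false

noncomputable section

open scoped Classical NumberField AddSubgroup

open NumberField IsDedekindDomain Field WeierstrassCurve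
  Literature.NumberTheory.GaloisRepresentations Literature.NumberTheory.EllipticCurves
  Literature.NumberTheory.EllipticCurves.GreenbergSelmer
  Literature.NumberTheory.EllipticCurves.GreenbergVatsal2000
  Literature.NumberTheory.EllipticCurves.EmertonPollackWeston2006
  Literature.NumberTheory.EllipticCurves.Rank1Residual
  Summit.BirchSwinnertonDyer.Rank1Residual.X2.TorsionComparison
  Summit.BirchSwinnertonDyer.Rank1Residual.X2.GreenbergVatsalTorsion

namespace Summit.BirchSwinnertonDyer.Rank1Residual.Additive

open Summit.BirchSwinnertonDyer.Rank1Residual.X1.CongruenceTransfer (TorsionIso)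
open Summit.BirchSwinnertonDyer.Rank1Residual.Additive.RamifiedOrdinaryLineQuotientModelFree

section Count

variable {p : ℕ} [hp : Fact p.Prime] {W₁ W₂ : WeierstrassCurve ℚ} [W₁.IsElliptic] [W₂.IsElliptic]
  (κ : ZpExtension ℚ p) (S₀ : Set (HeightOneSpectrum (𝓞 ℚ)))

/-- **GV's transfer COUNT for ANY two congruent curves with MATCHING ramified ordinary lines**
(`p` odd, any `ℤ_p`-extension `κ`): `E₁, E₂/ℚ` elliptic; at every `v ∋ p` ramified ordinary lines
`C_{1,v}`, `C_{2,v}` that match under every `Γ_ℚ`-equivariant `E₁[p] ≃+ E₂[p]`; `p ∤ #E₁(ℚ)_tors`;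
`E_i` good outside `S₀ ∪ {p}`; `E₁[p] ≅ E₂[p]`. Then there are data of ramified ordinary lines with
`#(S^{S₀}_{E₁[p^∞]}(ℚ_∞) ⊓ H¹[p]) = #(S^{S₀}_{E₂[p^∞]}(ℚ_∞) ⊓ H¹[p])`. The Remark-(2.9) clauses of the
gen-5 assembly are supplied by `gr_invariants_eq_zero_of_isRamifiedOrdinaryLine`; NO class
hypothesis, NO semistability defect, NO twist model.
[cite: GreenbergVatsal2000, §2 Prop. (2.8), Remark (2.9) and pp. 26–27] -/
theorem exists_data_natCard_gvSelmerInfty_inf_torsion_eq_of_matching (hp2 : p ≠ 2)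
    (hlines : ∀ (v : HeightOneSpectrum (𝓞 ℚ)) (hv : ((p : ℕ) : 𝓞 ℚ) ∈ v.asIdeal),
      ∃ (L₁ : LocalDatum ℚ (W₁.geomPrimaryTorsion p) v) (L₂ : LocalDatum ℚ (W₂.geomPrimaryTorsion p) v),
        IsRamifiedOrdinaryLine W₁ p L₁ ∧ IsRamifiedOrdinaryLine W₂ p L₂ ∧
        ∀ e : geomTorsion W₁ (p : ℤ) ≃+ geomTorsion W₂ (p : ℤ),
          (∀ (σ : absoluteGaloisGroup ℚ) (P : geomTorsion W₁ (p : ℤ)), e (σ • P) = σ • e P) →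
          ∀ P : geomTorsion W₁ (p : ℤ),
            AddSubgroup.inclusion (geomTorsion_le_geomPrimaryTorsion W₁ p) P ∈ L₁.plus ↔
              AddSubgroup.inclusion (geomTorsion_le_geomPrimaryTorsion W₂ p) (e P) ∈ L₂.plus)
    (htors₁ : ¬ p ∣ W₁.torsionOrder)
    (hS₁ : ∀ v : HeightOneSpectrum (𝓞 ℚ), v ∉ S₀ → ((p : ℕ) : 𝓞 ℚ) ∉ v.asIdeal →
      W₁.HasGoodReductionAt v)
    (hS₂ : ∀ v : HeightOneSpectrum (𝓞 ℚ), v ∉ S₀ → ((p : ℕ) : 𝓞 ℚ) ∉ v.asIdeal →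
      W₂.HasGoodReductionAt v)
    (hT : TorsionIso W₁ W₂ p) :
    ∃ (L₁ : Data ℚ (W₁.geomPrimaryTorsion p) p) (L₂ : Data ℚ (W₂.geomPrimaryTorsion p) p),
      (∀ v hv, IsRamifiedOrdinaryLine W₁ p (L₁ v hv)) ∧ (∀ v hv, IsRamifiedOrdinaryLine W₂ p (L₂ v hv)) ∧
      Nat.card (gvSelmerInfty κ (W₁.geomPrimaryTorsion p) L₁ S₀ ⊓
          (subgroupH1 κ.kerSubgroup (W₁.geomPrimaryTorsion p))[(p : ℤ)] :
          AddSubgroup (subgroupH1 κ.kerSubgroup (W₁.geomPrimaryTorsion p))) =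
        Nat.card (gvSelmerInfty κ (W₂.geomPrimaryTorsion p) L₂ S₀ ⊓
          (subgroupH1 κ.kerSubgroup (W₂.geomPrimaryTorsion p))[(p : ℤ)] :
          AddSubgroup (subgroupH1 κ.kerSubgroup (W₂.geomPrimaryTorsion p))) :=
  exists_data_natCard_gvSelmerInfty_inf_torsion_eq_of_forall_lines κ S₀
    (fun v hv ↦ by
      obtain ⟨L₁, L₂, hL₁, hL₂, hmatch⟩ := hlines v hv
      exact ⟨L₁, L₂, hL₁, hL₂, gr_invariants_eq_zero_of_isRamifiedOrdinaryLine hp2 hL₁ κ,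
        gr_invariants_eq_zero_of_isRamifiedOrdinaryLine hp2 hL₂ κ, hmatch⟩)
    htors₁ hS₁ hS₂ hT

/-- **`#Sel^{Σ₀}_{E₁}(ℚ_∞)_p[p] = #Sel^{Σ₀}_{E₂}(ℚ_∞)_p[p]` for ANY two congruent curves with MATCHING
ramified ordinary lines** (`p` odd, `κ` cyclotomic), modulo the R-D identifications
`RamifiedLineKummerEqAt W_i p` (explicit binders, as in gen 5 FILE 3): the count of
`exists_data_natCard_gvSelmerInfty_inf_torsion_eq_of_matching` read on the classical non-primitive
Selmer groups. [cite: GreenbergVatsal2000, §2 Prop. (2.8), Remark (2.9) and pp. 26–27] -/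
theorem natCard_torsionBy_nonPrimitiveSelmerInfty_eq_of_matching (hp2 : p ≠ 2) (hκ : κ.IsCyclotomic)
    (hlines : ∀ (v : HeightOneSpectrum (𝓞 ℚ)) (hv : ((p : ℕ) : 𝓞 ℚ) ∈ v.asIdeal),
      ∃ (L₁ : LocalDatum ℚ (W₁.geomPrimaryTorsion p) v) (L₂ : LocalDatum ℚ (W₂.geomPrimaryTorsion p) v),
        IsRamifiedOrdinaryLine W₁ p L₁ ∧ IsRamifiedOrdinaryLine W₂ p L₂ ∧
        ∀ e : geomTorsion W₁ (p : ℤ) ≃+ geomTorsion W₂ (p : ℤ),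
          (∀ (σ : absoluteGaloisGroup ℚ) (P : geomTorsion W₁ (p : ℤ)), e (σ • P) = σ • e P) →
          ∀ P : geomTorsion W₁ (p : ℤ),
            AddSubgroup.inclusion (geomTorsion_le_geomPrimaryTorsion W₁ p) P ∈ L₁.plus ↔
              AddSubgroup.inclusion (geomTorsion_le_geomPrimaryTorsion W₂ p) (e P) ∈ L₂.plus)
    (hRD₁ : RamifiedLineKummerEqAt W₁ p) (hRD₂ : RamifiedLineKummerEqAt W₂ p)
    (htors₁ : ¬ p ∣ W₁.torsionOrder)
    (hS₀ : ∀ v ∈ S₀, ((p : ℕ) : 𝓞 ℚ) ∉ v.asIdeal)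
    (hS₁ : ∀ v : HeightOneSpectrum (𝓞 ℚ), v ∉ S₀ → ((p : ℕ) : 𝓞 ℚ) ∉ v.asIdeal →
      W₁.HasGoodReductionAt v)
    (hS₂ : ∀ v : HeightOneSpectrum (𝓞 ℚ), v ∉ S₀ → ((p : ℕ) : 𝓞 ℚ) ∉ v.asIdeal →
      W₂.HasGoodReductionAt v)
    (hT : TorsionIso W₁ W₂ p) :
    Nat.card ((nonPrimitiveSelmerInfty W₁ κ S₀)[(p : ℤ)]) =
      Nat.card ((nonPrimitiveSelmerInfty W₂ κ S₀)[(p : ℤ)]) :=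
  natCard_torsionBy_nonPrimitiveSelmerInfty_eq_of_forall_lines κ S₀ hp2 hκ
    (fun v hv ↦ by
      obtain ⟨L₁, L₂, hL₁, hL₂, hmatch⟩ := hlines v hv
      exact ⟨L₁, L₂, hL₁, hL₂, gr_invariants_eq_zero_of_isRamifiedOrdinaryLine hp2 hL₁ κ,
        gr_invariants_eq_zero_of_isRamifiedOrdinaryLine hp2 hL₂ κ, hmatch⟩)
    hRD₁ hRD₂ htors₁ hS₀ hS₁ hS₂ hT

end Count

section Transfer

variable {p : ℕ} [hp : Fact p.Prime] {W₁ W₂ : WeierstrassCurve ℚ} [W₁.IsElliptic] [W₂.IsElliptic]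
  (κ : ZpExtension ℚ p) {γ : absoluteGaloisGroup ℚ} (S₀ : Set (HeightOneSpectrum (𝓞 ℚ)))

/-- **`μ`-TRANSFER for the non-primitive duals, any congruent pair with matching ramified ordinary
lines** (`p` odd, `κ` cyclotomic; mod the R-D binders): if a f.g. dual `X^{Σ₀}_1` of
`Sel^{Σ₀}_{E₁}(ℚ_∞)_p` is torsion with `μ = 0` then every f.g. dual `X^{Σ₀}_2` of `Sel^{Σ₀}_{E₂}(ℚ_∞)_p`
is torsion with `μ = 0` (GV p. 27 "if `μ_{E₁} = 0` then `μ_{E₂} = 0`", non-primitive level).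
[cite: GreenbergVatsal2000, §2 Prop. (2.8) and pp. 26–27] -/
theorem nonPrimitive_isTorsion_and_mu_eq_zero_of_matching (hp2 : p ≠ 2) (hκ : κ.IsCyclotomic)
    (hlines : ∀ (v : HeightOneSpectrum (𝓞 ℚ)) (hv : ((p : ℕ) : 𝓞 ℚ) ∈ v.asIdeal),
      ∃ (L₁ : LocalDatum ℚ (W₁.geomPrimaryTorsion p) v) (L₂ : LocalDatum ℚ (W₂.geomPrimaryTorsion p) v),
        IsRamifiedOrdinaryLine W₁ p L₁ ∧ IsRamifiedOrdinaryLine W₂ p L₂ ∧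
        ∀ e : geomTorsion W₁ (p : ℤ) ≃+ geomTorsion W₂ (p : ℤ),
          (∀ (σ : absoluteGaloisGroup ℚ) (P : geomTorsion W₁ (p : ℤ)), e (σ • P) = σ • e P) →
          ∀ P : geomTorsion W₁ (p : ℤ),
            AddSubgroup.inclusion (geomTorsion_le_geomPrimaryTorsion W₁ p) P ∈ L₁.plus ↔
              AddSubgroup.inclusion (geomTorsion_le_geomPrimaryTorsion W₂ p) (e P) ∈ L₂.plus)
    (hRD₁ : RamifiedLineKummerEqAt W₁ p) (hRD₂ : RamifiedLineKummerEqAt W₂ p)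
    (htors₁ : ¬ p ∣ W₁.torsionOrder)
    (hS₀ : ∀ v ∈ S₀, ((p : ℕ) : 𝓞 ℚ) ∉ v.asIdeal)
    (hS₁ : ∀ v : HeightOneSpectrum (𝓞 ℚ), v ∉ S₀ → ((p : ℕ) : 𝓞 ℚ) ∉ v.asIdeal →
      W₁.HasGoodReductionAt v)
    (hS₂ : ∀ v : HeightOneSpectrum (𝓞 ℚ), v ∉ S₀ → ((p : ℕ) : 𝓞 ℚ) ∉ v.asIdeal →
      W₂.HasGoodReductionAt v)
    (hT : TorsionIso W₁ W₂ p)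
    (DS₁ : NonPrimitiveDualData W₁ κ γ S₀) (DS₂ : NonPrimitiveDualData W₂ κ γ S₀)
    [Module.Finite (IwasawaAlgebra p) DS₁.X] [Module.Finite (IwasawaAlgebra p) DS₂.X]
    (ht₁ : Module.IsTorsion (IwasawaAlgebra p) DS₁.X) (hμ₁ : muInvariant p DS₁.X = 0) :
    Module.IsTorsion (IwasawaAlgebra p) DS₂.X ∧ muInvariant p DS₂.X = 0 :=
  nonPrimitive_isTorsion_and_mu_eq_zero_of_natCard_eq κ S₀
    (natCard_torsionBy_nonPrimitiveSelmerInfty_eq_of_matching κ S₀ hp2 hκ hlines hRD₁ hRD₂ htors₁ hS₀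
      hS₁ hS₂ hT) DS₁ DS₂ ht₁ hμ₁

/-- **`λ(X^{Σ₀}_1) = λ(X^{Σ₀}_2)` for any congruent pair with matching ramified ordinary lines** (with
the partner's cotorsion and `μ = 0`), given `X^{Σ₀}_1` torsion with `μ = 0` and both duals without
non-zero finite `Λ`-submodules (explicit binders `hnf_i`, as in gen 5 FILE 5) — GV p. 27
"`λ_{E₂,Σ₀} = λ_{E₁,Σ₀}`". [cite: GreenbergVatsal2000, §2 Prop. (2.8) and pp. 26–27] -/
theorem nonPrimitive_lambdaInvariant_eq_of_matching (hp2 : p ≠ 2) (hκ : κ.IsCyclotomic)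
    (hlines : ∀ (v : HeightOneSpectrum (𝓞 ℚ)) (hv : ((p : ℕ) : 𝓞 ℚ) ∈ v.asIdeal),
      ∃ (L₁ : LocalDatum ℚ (W₁.geomPrimaryTorsion p) v) (L₂ : LocalDatum ℚ (W₂.geomPrimaryTorsion p) v),
        IsRamifiedOrdinaryLine W₁ p L₁ ∧ IsRamifiedOrdinaryLine W₂ p L₂ ∧
        ∀ e : geomTorsion W₁ (p : ℤ) ≃+ geomTorsion W₂ (p : ℤ),
          (∀ (σ : absoluteGaloisGroup ℚ) (P : geomTorsion W₁ (p : ℤ)), e (σ • P) = σ • e P) →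
          ∀ P : geomTorsion W₁ (p : ℤ),
            AddSubgroup.inclusion (geomTorsion_le_geomPrimaryTorsion W₁ p) P ∈ L₁.plus ↔
              AddSubgroup.inclusion (geomTorsion_le_geomPrimaryTorsion W₂ p) (e P) ∈ L₂.plus)
    (hRD₁ : RamifiedLineKummerEqAt W₁ p) (hRD₂ : RamifiedLineKummerEqAt W₂ p)
    (htors₁ : ¬ p ∣ W₁.torsionOrder)
    (hS₀ : ∀ v ∈ S₀, ((p : ℕ) : 𝓞 ℚ) ∉ v.asIdeal)
    (hS₁ : ∀ v : HeightOneSpectrum (𝓞 ℚ), v ∉ S₀ → ((p : ℕ) : 𝓞 ℚ) ∉ v.asIdeal →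
      W₁.HasGoodReductionAt v)
    (hS₂ : ∀ v : HeightOneSpectrum (𝓞 ℚ), v ∉ S₀ → ((p : ℕ) : 𝓞 ℚ) ∉ v.asIdeal →
      W₂.HasGoodReductionAt v)
    (hT : TorsionIso W₁ W₂ p)
    (DS₁ : NonPrimitiveDualData W₁ κ γ S₀) (DS₂ : NonPrimitiveDualData W₂ κ γ S₀)
    [Module.Finite (IwasawaAlgebra p) DS₁.X] [Module.Finite (IwasawaAlgebra p) DS₂.X]
    (ht₁ : Module.IsTorsion (IwasawaAlgebra p) DS₁.X) (hμ₁ : muInvariant p DS₁.X = 0)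
    (hnf₁ : ∀ N : Submodule (IwasawaAlgebra p) DS₁.X, Finite N → N = ⊥)
    (hnf₂ : ∀ N : Submodule (IwasawaAlgebra p) DS₂.X, Finite N → N = ⊥) :
    Module.IsTorsion (IwasawaAlgebra p) DS₂.X ∧ muInvariant p DS₂.X = 0 ∧
      lambdaInvariant p DS₁.X = lambdaInvariant p DS₂.X :=
  nonPrimitive_lambdaInvariant_eq_of_natCard_eq κ S₀
    (natCard_torsionBy_nonPrimitiveSelmerInfty_eq_of_matching κ S₀ hp2 hκ hlines hRD₁ hRD₂ htors₁ hS₀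
      hS₁ hS₂ hT) DS₁ DS₂ ht₁ hμ₁ hnf₁ hnf₂

/-- **PRIMITIVE conclusion: `Sel_{p^∞}(E₂/ℚ_∞)` is `Λ`-COTORSION with `μ = 0`** (every dual datum `D₂`)
for any congruent pair with matching ramified ordinary lines, as soon as a f.g. non-primitive dual of
the partner `E₁` is torsion with `μ = 0` (`κ` cyclotomic with top generator `γ`; mod the R-D binders).
[cite: GreenbergVatsal2000, §2 Prop. (2.8) and pp. 26–27] [cite: GreenbergLNM1716, Prop. 5.10 (p. 147)] -/
theorem selmer_isTorsion_and_mu_eq_zero_of_matching (hp2 : p ≠ 2) (hκ : κ.IsCyclotomic)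
    (hγ : κ.IsTopGenerator γ)
    (hlines : ∀ (v : HeightOneSpectrum (𝓞 ℚ)) (hv : ((p : ℕ) : 𝓞 ℚ) ∈ v.asIdeal),
      ∃ (L₁ : LocalDatum ℚ (W₁.geomPrimaryTorsion p) v) (L₂ : LocalDatum ℚ (W₂.geomPrimaryTorsion p) v),
        IsRamifiedOrdinaryLine W₁ p L₁ ∧ IsRamifiedOrdinaryLine W₂ p L₂ ∧
        ∀ e : geomTorsion W₁ (p : ℤ) ≃+ geomTorsion W₂ (p : ℤ),
          (∀ (σ : absoluteGaloisGroup ℚ) (P : geomTorsion W₁ (p : ℤ)), e (σ • P) = σ • e P) →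
          ∀ P : geomTorsion W₁ (p : ℤ),
            AddSubgroup.inclusion (geomTorsion_le_geomPrimaryTorsion W₁ p) P ∈ L₁.plus ↔
              AddSubgroup.inclusion (geomTorsion_le_geomPrimaryTorsion W₂ p) (e P) ∈ L₂.plus)
    (hRD₁ : RamifiedLineKummerEqAt W₁ p) (hRD₂ : RamifiedLineKummerEqAt W₂ p)
    (htors₁ : ¬ p ∣ W₁.torsionOrder)
    (hS₀ : ∀ v ∈ S₀, ((p : ℕ) : 𝓞 ℚ) ∉ v.asIdeal)
    (hS₁ : ∀ v : HeightOneSpectrum (𝓞 ℚ), v ∉ S₀ → ((p : ℕ) : 𝓞 ℚ) ∉ v.asIdeal →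
      W₁.HasGoodReductionAt v)
    (hS₂ : ∀ v : HeightOneSpectrum (𝓞 ℚ), v ∉ S₀ → ((p : ℕ) : 𝓞 ℚ) ∉ v.asIdeal →
      W₂.HasGoodReductionAt v)
    (hT : TorsionIso W₁ W₂ p)
    (DS₁ : NonPrimitiveDualData W₁ κ γ S₀) [Module.Finite (IwasawaAlgebra p) DS₁.X]
    (ht₁ : Module.IsTorsion (IwasawaAlgebra p) DS₁.X) (hμ₁ : muInvariant p DS₁.X = 0)
    (D₂ : W₂.SelmerDualData κ γ) : D₂.IsTorsion ∧ D₂.mu = 0 :=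
  selmer_isTorsion_and_mu_eq_zero_of_natCard_eq κ S₀ hκ hγ
    (natCard_torsionBy_nonPrimitiveSelmerInfty_eq_of_matching κ S₀ hp2 hκ hlines hRD₁ hRD₂ htors₁ hS₀
      hS₁ hS₂ hT) DS₁ ht₁ hμ₁ D₂

end Transfer

end Summit.BirchSwinnertonDyer.Rank1Residual.Additive

end
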